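import Summits.CriticalPhenomena.Ising3DConformalLimit.Theorems.PrecisionLaplacianDirectCorrelationStableTailPickInversionAux4

/-!
# Green-to-direct-correlation transfer of the mass gap, auxiliary file 1:
# weak Stieltjes inversion below an arbitrary threshold, and the Poisson transform of a measure
# carried by `[0, θ₀]`

Helper file for the sub-stub `stub_slabModeExpDecay_auxGreenTransfer` (brick of
`stub_slabModeExpDecay`) of line `self-energy-pick-inversion`, crux
`PrecisionLaplacian.DirectCorrelationStableTail` (stmt-CriticalPhenomena-4799). Pure theorem file.

* `nevanlinna_measure_Iio_eq_zero_of_lt` (registered sub-goal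
  `stub_slabModeExpDecay_auxGreenTransfer2`): if `H` is continuous on the slit region
  `{Im z > 0} ∪ {Re z < s₀}`, real on `(-∞, s₀)`, and has the Nevanlinna representation
  `b + βz + π⁻¹ ∫ (1/(s - z) - s/(1 + s²)) dρ(s)` on the upper half-plane, then `ρ((-∞, s₀)) = 0`.
  Reduced to the case `s₀ = 1` of file `…PickInversionAux4` (`nevanlinna_measure_Iio_eq_zero`) by the
  real translation `w ↦ w + (s₀ - 1)`, which maps Nevanlinna representations to Nevanlinna
  representations (the kernel changes by the `ρ`-integrable real function
  `(s - d)/(1 + (s - d)²) - s/(1 + s²)`, absorbed into `b`).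
* The Poisson transform `F(z) = ∫ (1 - t²)/(1 - 2tz + t²) dμ(t)` of a finite measure carried by
  `[0, θ₀]`, `0 < θ₀ < 1`: the denominator does not vanish off the cut `[s₀, ∞)`,
  `s₀ = (θ₀ + θ₀⁻¹)/2 > 1`, so `F` is continuous on `{Im z > 0} ∪ {Re z < s₀}` and has no zeros there
  (`Re F > 0` at real points `x < s₀`, conjugation symmetry in the lower half-plane).

References: Rosenblum–Rovnyak, *Hardy classes and operator theory* (1985), App. §6, Theorem C;
Donoghue (1974), Ch. II; Akhiezer, *The classical moment problem*, Ch. 3.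
-/

noncomputable section

namespace Summit.CriticalPhenomena.Ising3DConformalLimit.Cruxes.DirectCorrelationStableTail.SelfEnergyPickInversion

open MeasureTheory Filter Topology Set Real Complex Metric
open scoped BigOperators ComplexConjugate
open Literature.Analysis.Complex

/-! ### Weak Stieltjes inversion below an arbitrary real threshold -/

/-- **Weak Stieltjes inversion below `s₀`.** Let `H` be continuous on the slit region
`{Im z > 0} ∪ {Re z < s₀}` and real on `(-∞, s₀)`, with Nevanlinna representation
`H(z) = b + βz + π⁻¹ ∫ (1/(s - z) - s/(1 + s²)) dρ(s)` on the upper half-plane (`β ≥ 0`,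
`∫ dρ/(1 + s²) < ∞`). Then `ρ((-∞, s₀)) = 0`. [folklore] -/
theorem nevanlinna_measure_Iio_eq_zero_of_lt {H : ℂ → ℂ} {b β s₀ : ℝ} {ρ : Measure ℝ}
    (hcont : ContinuousOn H {z : ℂ | 0 < z.im ∨ z.re < s₀}) (hreal : ∀ x : ℝ, x < s₀ → (H x).im = 0)
    (hβ : 0 ≤ β) (hρ : Integrable (fun s : ℝ => (1 + s ^ 2)⁻¹) ρ)
    (hrep : ∀ z ∈ UpperHalfPlane.upperHalfPlaneSet, H z = (b : ℂ) + (β : ℂ) * z +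
      (Real.pi : ℂ)⁻¹ * ∫ s : ℝ, (((s : ℂ) - z)⁻¹ - (s : ℂ) / (1 + (s : ℂ) ^ 2)) ∂ρ) :
    ρ (Set.Iio s₀) = 0 := by
  set d : ℝ := s₀ - 1 with hd
  -- the translated function and measure
  set H' : ℂ → ℂ := fun w => H (w + d) with hH'
  have hmeas : Measurable fun s : ℝ => s - d := measurable_id.sub_const d
  set ρ' : Measure ℝ := ρ.map (fun s : ℝ => s - d) with hρ'
  -- the weight `(1 + s²)⁻¹` under translation
  have hw : ∀ s : ℝ, (1 + (s - d) ^ 2)⁻¹ ≤ (2 * (1 + d ^ 2)) * (1 + s ^ 2)⁻¹ := by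
    intro s
    rw [← div_eq_mul_inv, le_div_iff₀ (by positivity), inv_mul_le_iff₀ (by positivity)]
    nlinarith [sq_nonneg (s - 2 * d), sq_nonneg (d * (s - d)), sq_nonneg d]
  have hρ'int : Integrable (fun s : ℝ => (1 + s ^ 2)⁻¹) ρ' := by
    rw [hρ', integrable_map_measure (by fun_prop) hmeas.aemeasurable]
    refine Integrable.mono' (hρ.const_mul (2 * (1 + d ^ 2))) (by fun_prop) (Eventually.of_forall fun s => ?_)
    simp only [Function.comp_apply, Real.norm_eq_abs]
    rw [abs_of_pos (by positivity)]
    exact hw s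
  -- continuity and realness of the translate
  have hcont' : ContinuousOn H' {w : ℂ | 0 < w.im ∨ w.re < 1} := by
    refine hcont.comp (by fun_prop) fun w hw' => ?_
    simp only [Set.mem_setOf_eq, Complex.add_im, Complex.ofReal_im, add_zero, Complex.add_re,
      Complex.ofReal_re] at hw' ⊢
    rcases hw' with h | h
    · exact Or.inl h
    · exact Or.inr (by rw [hd]; linarith)
  have hreal' : ∀ x : ℝ, x < 1 → (H' x).im = 0 := by
    intro x hx
    have : H' x = H ((x + d : ℝ) : ℂ) := by simp only [hH', Complex.ofReal_add]
    rw [this]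
    exact hreal _ (by rw [hd]; linarith)
  -- the kernel under translation: `K(s, w + d) = K(s - d, w) + δ(s)` with `δ` real
  set δ : ℝ → ℝ := fun s => (s - d) / (1 + (s - d) ^ 2) - s / (1 + s ^ 2) with hδ
  have hKδ : ∀ (s : ℝ) (w : ℂ), ((s : ℂ) - (w + d))⁻¹ - (s : ℂ) / (1 + (s : ℂ) ^ 2) =
      ((((s - d : ℝ) : ℂ) - w)⁻¹ - ((s - d : ℝ) : ℂ) / (1 + ((s - d : ℝ) : ℂ) ^ 2)) + (δ s : ℂ) := by
    intro s w
    have h1 : (s : ℂ) - (w + d) = ((s - d : ℝ) : ℂ) - w := by push_cast; ring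
    rw [h1]
    simp only [hδ]
    push_cast
    ring
  -- integrability of the pieces at a point `w` of the upper half-plane
  have hint : ∀ w : ℂ, 0 < w.im →
      Integrable (fun s : ℝ => (((s - d : ℝ) : ℂ) - w)⁻¹ - ((s - d : ℝ) : ℂ) / (1 + ((s - d : ℝ) : ℂ) ^ 2)) ρ ∧
      Integrable (fun s : ℝ => (δ s : ℂ)) ρ := by
    intro w hw'
    have h1 : Integrable (fun s : ℝ => ((s : ℂ) - w)⁻¹ - (s : ℂ) / (1 + (s : ℂ) ^ 2)) ρ' :=
      integrable_nevanlinna_kernel hρ'int hw'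
    rw [hρ', integrable_map_measure h1.aestronglyMeasurable hmeas.aemeasurable] at h1
    have h1' : Integrable (fun s : ℝ => (((s - d : ℝ) : ℂ) - w)⁻¹ - ((s - d : ℝ) : ℂ) /
        (1 + ((s - d : ℝ) : ℂ) ^ 2)) ρ := h1
    have hz : 0 < (w + (d : ℂ)).im := by simpa using hw'
    have h2 : Integrable (fun s : ℝ => ((s : ℂ) - (w + d))⁻¹ - (s : ℂ) / (1 + (s : ℂ) ^ 2)) ρ :=
      integrable_nevanlinna_kernel hρ hz
    refine ⟨h1', ?_⟩
    have h3 := h2.sub h1'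
    refine h3.congr (Eventually.of_forall fun s => ?_)
    simp only [Pi.sub_apply]
    rw [hKδ s w]
    ring
  have hδint : Integrable δ ρ := by
    have h := (hint I (by simp)).2
    have := h.re
    simpa using this
  -- the representation of the translate
  set b' : ℝ := b + β * d + π⁻¹ * ∫ s, δ s ∂ρ with hb'
  have hrep' : ∀ w ∈ UpperHalfPlane.upperHalfPlaneSet, H' w = (b' : ℂ) + (β : ℂ) * w +
      (Real.pi : ℂ)⁻¹ * ∫ s : ℝ, (((s : ℂ) - w)⁻¹ - (s : ℂ) / (1 + (s : ℂ) ^ 2)) ∂ρ' := by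
    intro w hw'
    have hw'' : 0 < w.im := hw'
    have hz : (w + (d : ℂ)) ∈ UpperHalfPlane.upperHalfPlaneSet := by
      show 0 < (w + (d : ℂ)).im
      simpa using hw''
    obtain ⟨h1, h2⟩ := hint w hw''
    have hmap : ∫ s : ℝ, (((s : ℂ) - w)⁻¹ - (s : ℂ) / (1 + (s : ℂ) ^ 2)) ∂ρ' =
        ∫ s : ℝ, ((((s - d : ℝ) : ℂ) - w)⁻¹ - ((s - d : ℝ) : ℂ) / (1 + ((s - d : ℝ) : ℂ) ^ 2)) ∂ρ := by
      rw [hρ', integral_map hmeas.aemeasurable]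
      exact (integrable_nevanlinna_kernel hρ'int hw'').aestronglyMeasurable
    have hsplit : ∫ s : ℝ, (((s : ℂ) - (w + d))⁻¹ - (s : ℂ) / (1 + (s : ℂ) ^ 2)) ∂ρ =
        (∫ s : ℝ, ((((s - d : ℝ) : ℂ) - w)⁻¹ - ((s - d : ℝ) : ℂ) / (1 + ((s - d : ℝ) : ℂ) ^ 2)) ∂ρ) +
          ((∫ s, δ s ∂ρ : ℝ) : ℂ) := by
      have hδC : ∫ s, (δ s : ℂ) ∂ρ = ((∫ s, δ s ∂ρ : ℝ) : ℂ) := _root_.integral_ofReal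
      rw [← hδC, ← integral_add h1 h2]
      exact integral_congr_ae (Eventually.of_forall fun s => hKδ s w)
    simp only [hH']
    rw [hrep _ hz, hsplit, hmap, hb']
    have hpi : ((Real.pi : ℂ)⁻¹) = ((Real.pi⁻¹ : ℝ) : ℂ) := by push_cast; rfl
    rw [hpi]
    push_cast
    ring
  -- conclusion
  have h0 : ρ' (Set.Iio 1) = 0 := nevanlinna_measure_Iio_eq_zero hcont' hreal' hβ hρ'int hrep'
  rw [hρ', Measure.map_apply hmeas measurableSet_Iio, Set.preimage_sub_const_Iio] at h0
  have h1d : (1 : ℝ) + d = s₀ := by rw [hd]; ring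
  rwa [h1d] at h0

/-! ### The Poisson transform of a measure carried by `[0, θ₀]`, `0 < θ₀ < 1` -/

/-- Off the cut `[s₀, ∞)`, `s₀ = (θ₀ + θ₀⁻¹)/2`, the denominator `1 - 2tz + t²` does not vanish for
`t ∈ [0, θ₀]` (`0 < θ₀ ≤ 1`). [folklore] -/
theorem poissonDen_ne_zero_of_le {θ₀ t : ℝ} (hθ₀ : 0 < θ₀) (hθ₁ : θ₀ ≤ 1) (ht : t ∈ Set.Icc (0 : ℝ) θ₀)
    {z : ℂ} (hz : z.im ≠ 0 ∨ z.re < (θ₀ + θ₀⁻¹) / 2) :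
    (1 - 2 * (t : ℂ) * z + (t : ℂ) ^ 2) ≠ 0 := by
  obtain ⟨hre, him⟩ := poissonDen_re_im t z
  intro h
  have h1 := congrArg Complex.re h
  have h2 := congrArg Complex.im h
  rw [hre, Complex.zero_re] at h1
  rw [him, Complex.zero_im] at h2
  have ht0 : t ≠ 0 := by rintro rfl; norm_num at h1
  have htpos : 0 < t := lt_of_le_of_ne ht.1 (Ne.symm ht0)
  have hzim : z.im = 0 := by
    have h3 : 2 * t * z.im = 0 := by linarith
    rcases mul_eq_zero.1 h3 with h4 | h4
    · exfalso; exact ht0 (by linarith)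
    · exact h4
  rcases hz with hz | hz
  · exact hz hzim
  · have hs : 2 * θ₀ * z.re < θ₀ ^ 2 + 1 := by
      have h3 := mul_lt_mul_of_pos_left hz (by positivity : (0 : ℝ) < 2 * θ₀)
      have h4 : 2 * θ₀ * ((θ₀ + θ₀⁻¹) / 2) = θ₀ ^ 2 + 1 := by field_simp
      linarith [h4]
    have h5 := mul_lt_mul_of_pos_left hs htpos
    have h6 : 0 ≤ (θ₀ - t) * (1 - t * θ₀) :=
      mul_nonneg (sub_nonneg.2 ht.2) (by nlinarith [ht.1, ht.2])
    nlinarith [h5, h6, h1]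

/-- The slit region `{Im z > 0} ∪ {Re z < s₀}` is open. [folklore] -/
theorem isOpen_slitRegion_lt (s₀ : ℝ) : IsOpen {z : ℂ | 0 < z.im ∨ z.re < s₀} :=
  (isOpen_lt continuous_const Complex.continuous_im).union (isOpen_lt Complex.continuous_re continuous_const)

/-- **Uniform lower bound for the denominator** near a point of `{Im z > 0} ∪ {Re z < s₀}`,
`s₀ = (θ₀ + θ₀⁻¹)/2`: there are `R > 0` and `m > 0` with `ball z₀ R` inside the region and
`m ≤ |1 - 2tz + t²|` for `t ∈ [0, θ₀]`, `z ∈ ball z₀ R`. [folklore] -/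
theorem exists_poissonDen_lower_bound_of_le {θ₀ : ℝ} (hθ₀ : 0 < θ₀) (hθ₁ : θ₀ ≤ 1) {z₀ : ℂ}
    (hz₀ : 0 < z₀.im ∨ z₀.re < (θ₀ + θ₀⁻¹) / 2) :
    ∃ R m : ℝ, 0 < R ∧ 0 < m ∧ ball z₀ R ⊆ {z : ℂ | 0 < z.im ∨ z.re < (θ₀ + θ₀⁻¹) / 2} ∧
      ∀ t ∈ Set.Icc (0 : ℝ) θ₀, ∀ z ∈ ball z₀ R, m ≤ ‖1 - 2 * (t : ℂ) * z + (t : ℂ) ^ 2‖ := by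
  -- adapted from `exists_poissonDen_lower_bound` (file `…PickInversionAux3`)
  obtain ⟨R₀, hR₀, hball⟩ := Metric.isOpen_iff.mp (isOpen_slitRegion_lt ((θ₀ + θ₀⁻¹) / 2)) z₀ hz₀
  set R : ℝ := R₀ / 2 with hR
  have hRpos : 0 < R := by positivity
  have hcb : closedBall z₀ R ⊆ {z : ℂ | 0 < z.im ∨ z.re < (θ₀ + θ₀⁻¹) / 2} :=
    (closedBall_subset_ball (by rw [hR]; linarith)).trans hball
  set K : Set (ℝ × ℂ) := Set.Icc (0 : ℝ) θ₀ ×ˢ closedBall z₀ R with hK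
  have hKc : IsCompact K := isCompact_Icc.prod (isCompact_closedBall z₀ R)
  have hKne : K.Nonempty := ⟨(0, z₀), ⟨le_rfl, hθ₀.le⟩, mem_closedBall_self hRpos.le⟩
  have h1 : Continuous fun p : ℝ × ℂ => (p.1 : ℂ) := Complex.continuous_ofReal.comp continuous_fst
  have hcont : ContinuousOn (fun p : ℝ × ℂ => ‖1 - 2 * (p.1 : ℂ) * p.2 + (p.1 : ℂ) ^ 2‖) K :=
    ((continuous_const.sub ((continuous_const.mul h1).mul continuous_snd)).add (h1.pow 2)).norm
      |>.continuousOn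
  obtain ⟨p₀, hp₀K, hp₀⟩ := hKc.exists_isMinOn hKne hcont
  obtain ⟨t₀, w₀⟩ := p₀
  have hw₀ : w₀.im ≠ 0 ∨ w₀.re < (θ₀ + θ₀⁻¹) / 2 := by
    rcases hcb hp₀K.2 with h | h
    · exact Or.inl h.ne'
    · exact Or.inr h
  have hmpos : 0 < ‖1 - 2 * (t₀ : ℂ) * w₀ + (t₀ : ℂ) ^ 2‖ :=
    norm_pos_iff.mpr (poissonDen_ne_zero_of_le hθ₀ hθ₁ hp₀K.1 hw₀)
  have hmle : ∀ t ∈ Set.Icc (0 : ℝ) θ₀, ∀ z ∈ ball z₀ R,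
      ‖1 - 2 * (t₀ : ℂ) * w₀ + (t₀ : ℂ) ^ 2‖ ≤ ‖1 - 2 * (t : ℂ) * z + (t : ℂ) ^ 2‖ := by
    intro t ht z hz
    have hmem : ((t, z) : ℝ × ℂ) ∈ K := ⟨ht, ball_subset_closedBall hz⟩
    exact (isMinOn_iff.mp hp₀) (t, z) hmem
  exact ⟨R, _, hRpos, hmpos, ball_subset_closedBall.trans hcb, hmle⟩

/-- Integrability of the Poisson integrand at every point of `{Im z > 0} ∪ {Re z < s₀}` for a finite
measure carried by `[0, θ₀]`. [folklore] -/
theorem integrable_poissonIntegrand_of_le (μ : Measure ℝ) [IsFiniteMeasure μ] {θ₀ : ℝ}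
    (hθ₀ : 0 < θ₀) (hθ₁ : θ₀ ≤ 1) (hμ : μ (Set.Icc (0 : ℝ) θ₀)ᶜ = 0) {z : ℂ}
    (hz : 0 < z.im ∨ z.re < (θ₀ + θ₀⁻¹) / 2) :
    Integrable (fun t : ℝ => ((1 - t ^ 2 : ℝ) : ℂ) / (1 - 2 * (t : ℂ) * z + (t : ℂ) ^ 2)) μ := by
  have hae : ∀ᵐ t ∂μ, t ∈ Set.Icc (0 : ℝ) θ₀ := by
    rw [ae_iff]; simpa only [Set.mem_setOf_eq, ← Set.mem_compl_iff, Set.setOf_mem_eq] using hμ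
  obtain ⟨R, m, hR, hm, -, hbound⟩ := exists_poissonDen_lower_bound_of_le hθ₀ hθ₁ hz
  refine Integrable.mono' (integrable_const (1 / m)) (measurable_poissonIntegrand z).aestronglyMeasurable ?_
  filter_upwards [hae] with t ht
  exact norm_poissonIntegrand_le ⟨ht.1, ht.2.trans hθ₁⟩ hm (hbound t ht z (mem_ball_self hR))

/-- **Holomorphy of the Poisson transform** of a finite measure carried by `[0, θ₀]` on the larger
slit region `{Im z > 0} ∪ {Re z < s₀}`, `s₀ = (θ₀ + θ₀⁻¹)/2`. [folklore] -/
theorem differentiableOn_poissonTransform_of_le (μ : Measure ℝ) [IsFiniteMeasure μ] {θ₀ : ℝ}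
    (hθ₀ : 0 < θ₀) (hθ₁ : θ₀ ≤ 1) (hμ : μ (Set.Icc (0 : ℝ) θ₀)ᶜ = 0) :
    DifferentiableOn ℂ (fun z : ℂ => ∫ t, ((1 - t ^ 2 : ℝ) : ℂ) / (1 - 2 * (t : ℂ) * z + (t : ℂ) ^ 2) ∂μ)
      {z : ℂ | 0 < z.im ∨ z.re < (θ₀ + θ₀⁻¹) / 2} := by
  -- adapted from `differentiableOn_poissonTransform` (file `…PickInversionAux3`)
  have hae : ∀ᵐ t ∂μ, t ∈ Set.Icc (0 : ℝ) θ₀ := by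
    rw [ae_iff]; simpa only [Set.mem_setOf_eq, ← Set.mem_compl_iff, Set.setOf_mem_eq] using hμ
  apply differentiableOn_integral_of_dominated
  · exact fun z _ => (measurable_poissonIntegrand z).aestronglyMeasurable
  · filter_upwards [hae] with t ht
    refine DifferentiableOn.div (differentiableOn_const _) (by fun_prop) fun z hz => ?_
    refine poissonDen_ne_zero_of_le hθ₀ hθ₁ ht ?_
    rcases hz with h | h
    · exact Or.inl h.ne'
    · exact Or.inr h
  · intro z₀ hz₀
    obtain ⟨R, m, hR, hm, hballU, hbound⟩ := exists_poissonDen_lower_bound_of_le hθ₀ hθ₁ hz₀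
    refine ⟨R, hR, hballU, fun _ => 1 / m, integrable_const _, ?_⟩
    filter_upwards [hae] with t ht
    intro z hz
    exact norm_poissonIntegrand_le ⟨ht.1, ht.2.trans hθ₁⟩ hm (hbound t ht z hz)

/-- Conjugation symmetry of the Poisson transform: `F(z̄) = conj F(z)`. [folklore] -/
theorem poissonTransform_conj (μ : Measure ℝ) (z : ℂ) :
    (∫ t, ((1 - t ^ 2 : ℝ) : ℂ) / (1 - 2 * (t : ℂ) * (conj z) + (t : ℂ) ^ 2) ∂μ) =
      conj (∫ t, ((1 - t ^ 2 : ℝ) : ℂ) / (1 - 2 * (t : ℂ) * z + (t : ℂ) ^ 2) ∂μ) := by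
  rw [← integral_conj]
  refine integral_congr_ae (Eventually.of_forall fun t => ?_)
  simp only [map_div₀, map_sub, map_add, map_mul, map_one, map_pow, Complex.conj_ofReal, map_ofNat]

/-- **Positivity on the real axis below the cut**: for a finite nonzero measure carried by `[0, θ₀]`
(`0 < θ₀ < 1`) and real `x < s₀ = (θ₀ + θ₀⁻¹)/2`, `Re F(x) > 0`. [folklore] -/
theorem poissonTransform_re_pos_of_le (μ : Measure ℝ) [IsFiniteMeasure μ] {θ₀ : ℝ}
    (hθ₀ : 0 < θ₀) (hθ₁ : θ₀ < 1) (hμ : μ (Set.Icc (0 : ℝ) θ₀)ᶜ = 0) (hμ0 : μ Set.univ ≠ 0)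
    {x : ℝ} (hx : x < (θ₀ + θ₀⁻¹) / 2) :
    0 < (∫ t, ((1 - t ^ 2 : ℝ) : ℂ) / (1 - 2 * (t : ℂ) * (x : ℂ) + (t : ℂ) ^ 2) ∂μ).re := by
  have hae : ∀ᵐ t ∂μ, t ∈ Set.Icc (0 : ℝ) θ₀ := by
    rw [ae_iff]; simpa only [Set.mem_setOf_eq, ← Set.mem_compl_iff, Set.setOf_mem_eq] using hμ
  have hz : 0 < (x : ℂ).im ∨ (x : ℂ).re < (θ₀ + θ₀⁻¹) / 2 := Or.inr (by simpa using hx)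
  have hint := integrable_poissonIntegrand_of_le μ hθ₀ hθ₁.le hμ hz
  have hre := integral_re hint
  simp only [RCLike.re_to_complex] at hre
  rw [← hre]
  -- the real integrand `(1 - t²)/(1 - 2tx + t²)` is positive on `[0, θ₀]`
  have hs : 2 * θ₀ * x < θ₀ ^ 2 + 1 := by
    have h3 := mul_lt_mul_of_pos_left hx (by positivity : (0 : ℝ) < 2 * θ₀)
    have h4 : 2 * θ₀ * ((θ₀ + θ₀⁻¹) / 2) = θ₀ ^ 2 + 1 := by field_simp
    linarith [h4]
  have hden : ∀ t ∈ Set.Icc (0 : ℝ) θ₀, 0 < 1 - 2 * t * x + t ^ 2 := by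
    intro t ht
    rcases ht.1.lt_or_eq with htpos | ht0
    · have h5 := mul_lt_mul_of_pos_left hs htpos
      have h6 : 0 ≤ (θ₀ - t) * (1 - t * θ₀) :=
        mul_nonneg (sub_nonneg.2 ht.2) (by nlinarith [ht.1, ht.2])
      nlinarith [h5, h6]
    · rw [← ht0]; norm_num
  have hpt : ∀ t ∈ Set.Icc (0 : ℝ) θ₀,
      (((1 - t ^ 2 : ℝ) : ℂ) / (1 - 2 * (t : ℂ) * (x : ℂ) + (t : ℂ) ^ 2)).re =
        (1 - t ^ 2) / (1 - 2 * t * x + t ^ 2) := by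
    intro t ht
    have h : ((1 - t ^ 2 : ℝ) : ℂ) / (1 - 2 * (t : ℂ) * (x : ℂ) + (t : ℂ) ^ 2) =
        (((1 - t ^ 2) / (1 - 2 * t * x + t ^ 2) : ℝ) : ℂ) := by push_cast; ring
    rw [h, Complex.ofReal_re]
  have hpos : ∀ t ∈ Set.Icc (0 : ℝ) θ₀,
      0 < (((1 - t ^ 2 : ℝ) : ℂ) / (1 - 2 * (t : ℂ) * (x : ℂ) + (t : ℂ) ^ 2)).re := by
    intro t ht
    rw [hpt t ht]
    exact div_pos (by nlinarith [ht.1, ht.2]) (hden t ht)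
  rw [integral_pos_iff_support_of_nonneg_ae (hae.mono fun t ht => (hpos t ht).le) hint.re]
  have hsub : Set.Icc (0 : ℝ) θ₀ ⊆ Function.support fun t =>
      (((1 - t ^ 2 : ℝ) : ℂ) / (1 - 2 * (t : ℂ) * (x : ℂ) + (t : ℂ) ^ 2)).re :=
    fun t ht => (hpos t ht).ne'
  refine lt_of_lt_of_le ?_ (measure_mono hsub)
  rw [pos_iff_ne_zero]
  intro h0
  refine hμ0 (measure_mono_null (fun t _ => ?_) (measure_union_null h0 hμ))
  by_cases ht : t ∈ Set.Icc (0 : ℝ) θ₀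
  · exact Or.inl ht
  · exact Or.inr ht

/-- **Non-vanishing of the Poisson transform off the cut**: for a finite nonzero measure carried by
`[0, θ₀]` (`0 < θ₀ < 1`), `F(z) ≠ 0` on `{Im z > 0} ∪ {Re z < s₀}`. [folklore] -/
theorem poissonTransform_ne_zero_of_le (μ : Measure ℝ) [IsFiniteMeasure μ] {θ₀ : ℝ}
    (hθ₀ : 0 < θ₀) (hθ₁ : θ₀ < 1) (hμ : μ (Set.Icc (0 : ℝ) θ₀)ᶜ = 0) (hμ0 : μ Set.univ ≠ 0) {z : ℂ}
    (hz : 0 < z.im ∨ z.re < (θ₀ + θ₀⁻¹) / 2) :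
    (∫ t, ((1 - t ^ 2 : ℝ) : ℂ) / (1 - 2 * (t : ℂ) * z + (t : ℂ) ^ 2) ∂μ) ≠ 0 := by
  have hμ1 : μ (Set.Icc (0 : ℝ) 1)ᶜ = 0 :=
    measure_mono_null (Set.compl_subset_compl.2 (Set.Icc_subset_Icc_right hθ₁.le)) hμ
  have hμ0' : μ (Set.Ico (0 : ℝ) 1) ≠ 0 := by
    intro h0
    refine hμ0 ?_
    have : (Set.univ : Set ℝ) ⊆ Set.Ico (0 : ℝ) 1 ∪ (Set.Icc (0 : ℝ) θ₀)ᶜ := by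
      intro t _
      by_cases ht : t ∈ Set.Icc (0 : ℝ) θ₀
      · exact Or.inl ⟨ht.1, lt_of_le_of_lt ht.2 hθ₁⟩
      · exact Or.inr ht
    exact measure_mono_null this (measure_union_null h0 hμ)
  rcases lt_trichotomy z.im 0 with him | him | him
  · -- lower half-plane: conjugate
    intro h0
    have h1 : 0 < (conj z).im ∨ (conj z).re < 1 := Or.inl (by simpa using him)
    have h2 := poissonTransform_ne_zero μ hμ1 hμ0' h1
    rw [poissonTransform_conj, h0, map_zero] at h2
    exact h2 rfl
  · -- real axis below the cut
    have hzx : z = (z.re : ℂ) := by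
      apply Complex.ext <;> simp [him]
    have hx : z.re < (θ₀ + θ₀⁻¹) / 2 := by
      rcases hz with h | h
      · exact absurd him h.ne'
      · exact h
    rw [hzx]
    intro h0
    have := poissonTransform_re_pos_of_le μ hθ₀ hθ₁ hμ hμ0 hx
    rw [h0, Complex.zero_re] at this
    exact lt_irrefl _ this
  · exact poissonTransform_ne_zero μ hμ1 hμ0' (Or.inl him)

/-- **Registered auxiliary stub `stub_slabModeExpDecay_auxGreenTransfer2`** (sub-goal of the brick
`stub_slabModeExpDecay_auxGreenTransfer` of `stub_slabModeExpDecay`): weak Stieltjes inversion below an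
arbitrary real threshold `s₀` (`nevanlinna_measure_Iio_eq_zero_of_lt`) — the Nevanlinna measure of a
Pick function that is continuous on `{Im z > 0} ∪ {Re z < s₀}` and real on `(-∞, s₀)` does not charge
`(-∞, s₀)`. [folklore] -/
theorem stub_slabModeExpDecay_auxGreenTransfer2 : ∀ (H : ℂ → ℂ) (b β s₀ : ℝ) (ρ : MeasureTheory.Measure ℝ),
    ContinuousOn H {z : ℂ | 0 < z.im ∨ z.re < s₀} → (∀ x : ℝ, x < s₀ → (H x).im = 0) → 0 ≤ β →
    MeasureTheory.Integrable (fun s : ℝ => (1 + s ^ 2)⁻¹) ρ →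
    (∀ z ∈ UpperHalfPlane.upperHalfPlaneSet, H z = (b : ℂ) + (β : ℂ) * z +
      (Real.pi : ℂ)⁻¹ * ∫ s : ℝ, (((s : ℂ) - z)⁻¹ - (s : ℂ) / (1 + (s : ℂ) ^ 2)) ∂ρ) →
    ρ (Set.Iio s₀) = 0 :=
  fun _ _ _ _ _ hcont hreal hβ hρ hrep => nevanlinna_measure_Iio_eq_zero_of_lt hcont hreal hβ hρ hrep

end Summit.CriticalPhenomena.Ising3DConformalLimit.Cruxes.DirectCorrelationStableTail.SelfEnergyPickInversion

end
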